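import Literature.AlgebraicGeometry.ShimuraVarieties.UnitaryAuxiliaryTorusDatumExt
import Literature.AlgebraicGeometry.ShimuraVarieties.UnitaryAuxiliaryHeckeQuotientDescentExt
import Literature.AlgebraicGeometry.ShimuraVarieties.UnitaryAuxiliaryTorusReflexNorm
import Literature.AlgebraicGeometry.ShimuraVarieties.UnitaryShimuraCanonicalModelNonVacuity
import Literature.AlgebraicGeometry.ShimuraVarieties.UnitaryShimuraComplexFibreGalois
import Literature.NumberTheory.Automorphic.UnitaryGroupFrameHermitian
import Literature.AlgebraicGeometry.Motives.FiniteCoproductVarieties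
import Literature.AlgebraicGeometry.Motives.HypersurfaceFieldPoints
import Literature.AlgebraicGeometry.Motives.ComplexPointsZariskiDense
import Literature.AlgebraicGeometry.ShimuraVarieties.UnitaryAuxiliarySpecialPairsDense
import Literature.AlgebraicGeometry.ShimuraVarieties.UnitaryAuxiliaryTorusDatumExtPoints
import Literature.AlgebraicGeometry.ShimuraVarieties.UnitaryShimuraFormProperties
import Literature.AlgebraicGeometry.Motives.ComplexAutGaloisDescentIdealSheaf
import Literature.AlgebraicGeometry.Motives.ComplexAutGaloisDescentOfDense
import Literature.AlgebraicGeometry.Motives.ComplexPointsGaloisUnderlying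
import Literature.AlgebraicGeometry.Motives.FaithfulFunctorTowerDescent
import HarnessLib

/-!
# τ0-T3 (1/4) — the Ext ambient-receptacle VOCABULARY: `ReciprocityThrough`, `ImageStable`, `AmbientReceptacle`, and the three statements `AmbientReceptacleExists`, `ImageStableOfReciprocity`, `ClosureDescent`

Cell `hodgecm-mathlib`, crux `HDel` (stmt-HodgeConjecture-24835), fan B / B-plan2 (T3 pen), KEY `t3-tau0-ext-receptacle-port` (B-p19 g5).
τ0-T3 RELOCATES, VERBATIM, the vocabulary and the kernel-checked reductions of the planning workfile
`Summits/HodgeConjecture/HodgeConjecture/Cruxes/HDel/Lines/F1ExtHodgeType.lean` v3b (sha16 2a4912bcb51bc6f9; B-plan2 g2–g4) into IMPORTABLE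
Summits modules (namespace `Summit.HodgeConjecture.CorCM.HypDel.ExtReceptacle`; split in four files by the gate's 400-line rule, workfile order kept:
`ExtAmbientReceptacle` §1–§2 · `ExtAmbientReceptacleImageStable` §3 · `ExtAmbientReceptacleLevelForm` §3b first half ·
`ExtAmbientReceptacleHDel` §3b second half + head + §5 + §7), so that v4's stubs, their leaf closers and the final by-name `HDel` closer can
`import` these names (a Cruxes workfile is not importable by Theorems files — the τ0 / T4 lesson, ★ p633409).  Statements, binders and proofs
are byte-identical to v3b; relocation edits only (the workfile's one open stub, its consumer and the skeleton head are NOT carried; the six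
closed `stub_*` theorems are renamed `*_holds`; the v2 census §6 is dropped).  NOTHING NEW IS ASSERTED; 0 `sorry`.
STATEMENT CONVENTIONS (unchanged): every binder block is the binder block of `Aux.canonicalModel_exists_ext_printed` VERBATIM (B-typ04 ★ p608274),
and `ReciprocityThrough` is the body of `Aux.IsCanonicalDescentAtExt` VERBATIM with the form `(N.obj K, e.inv.app K)` replaced by a receptacle
`(A, ι)`; no new Literature notion, no instance, no notation.

THIS FILE (1/4): §1 the receptacle vocabulary and §2 the three statements (workfile :104–:258); definitions only.
HC_CM is proved only modulo the 7 printed citations until rung 0 closes; nothing in this file is a proof of I-1′ or of `HDel`.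
[cite: Deligne1971TravauxShimura, Cor. 5.7 p. 156, Exemple 5.8 and Variante 5.9 p. 157, Prop. 1.15 p. 132, 5.2 p. 155, Thm. 4.21 p. 152]
[cite: Deligne1979ShimuraVarieties, Criterion 2.3.1 and 2.2.5 (PDF p. 29), Prop. 2.3.10 (PDF p. 32) of Milne's translation]
[cite: MumfordFogartyKirwan1994, Ch. 7 §3 Thm. 7.9] [cite: Shimura1998, §18.6 Thm. 18.6] [cite: Milne2005ShimuraVarieties, Def. 12.8 (62) p. 114, §13 p. 117, §14 pp. 126–127]
-/

open Function MulAction Topology NumberField IsDedekindDomain CategoryTheory CategoryTheory.Limits Matrix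
  AlgebraicGeometry
open scoped Matrix ComplexOrder
open Literature.AlgebraicGeometry Literature.AlgebraicGeometry.Motives
open Literature.NumberTheory.Automorphic Literature.NumberTheory.Automorphic.UnitaryGroup
open Literature.NumberTheory.Automorphic.Liu2021.AppendixC (C5.OpenCompactSubgroup C5.SmallLevel)
open Literature.Geometry.ComplexHyperbolic Literature.Geometry.ComplexHyperbolic.BallModel
open Literature.NumberTheory.Automorphic.ShimuraDissection
open Literature.AlgebraicGeometry.ShimuraVarieties Literature.AlgebraicGeometry.ShimuraVarieties.UnitaryCanonicalModel
open Literature.AlgebraicGeometry.ShimuraVarieties.UnitaryCanonicalModel.Aux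
open Literature.NumberTheory.ComplexMultiplication (traceField reflexNormFiniteIdele)
open Literature.NumberTheory.AdelicBaseChange (finiteIdeleRelNorm)

namespace Summit.HodgeConjecture.CorCM.HypDel.ExtReceptacle

/-! ### §1. Reciprocity (62) READ IN A RECEPTACLE: the body of `Aux.IsCanonicalDescentAtExt` with the form replaced by `(A, ι)` -/

section Receptacle

variable {L : Type} [Field L] [NumberField L] [IsCMField L]
variable {H : Matrix (Fin 3) (Fin 3) L} {τ : L →+* ℂ} {T : GL (Fin 3) ℂ}
  {hT : formCongr (starRingEnd ℂ) T (H.map τ) = BallModel.J}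
  {K₀ : C5.OpenCompactSubgroup ↥(finAdelic (↥(maximalRealSubfield L)) L (IsCMField.complexConj L) 3 H)}
variable (M : Type) [Field M] [NumberField M] [IsCMField M]

/-- **Shimura reciprocity (62) at the diagonal special pairs, read in a RECEPTACLE `(A, ι)` of level `K`** — the body of
`Aux.IsCanonicalDescentAtExt M Φ E hE L₀ Sc N e` VERBATIM at ONE level `K`, with the `E`-form `N.obj K` replaced by an arbitrary `E`-scheme `A`
and the comparison `e.inv.app K` by an arbitrary `ℂ`-morphism `ι : Sh_{K×L₀}(G̃_M, X̃_M)_ℂ ⟶ A ⊗_E ℂ` (intended: the closed immersion of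
[Deligne 1971] Prop. 1.15 into the Siegel modular variety): for `σ ∈ Aut(ℂ/E)`, `s` with `art_E(s) = σ|`, a line point `x`, a diagonal twist `d` by
`r_x(N_{E/τL} s)`, `t = N_{E,Φ}(s)`, every `a` and summand `p`:  `σ • ι([x, aK], p) = ι([x, d·aK], t·p)` as points of the `E`-scheme `A`.  For the
Siegel receptacle this IS the main theorem of complex multiplication at the CM points `ι([x,aK],p)` (S4).  A predicate; nothing asserted.
[cite: Milne2005ShimuraVarieties, Def. 12.8 (60)–(62) p. 114; Rem. 12.9 p. 115] [cite: Deligne1971TravauxShimura, Thm. 4.21 p. 152, Exemple 5.8 p. 157]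
[cite: Shimura1998, §18.6 Thm. 18.6 (1)–(2) p. 127] -/
def ReciprocityThrough (Φ : CMType M) (E : IntermediateField ℚ ℂ) [FiniteDimensional ℚ ↥E] (hE : ∀ x : L, τ x ∈ E)
    (L₀ : C5.OpenCompactSubgroup ↥(torusFinAdelic M)) (Sc : ComplexRecordSystem L H τ T hT K₀) (K : C5.SmallLevel K₀)
    (A : SchemeOver ↥E) (ι : (complexSystemExt M Sc L₀).obj K ⟶ (Motives.baseChange ↥E ℂ).obj A) : Prop :=
  haveI : NumberField ↥E := NumberField.mk
  letI : Algebra L ↥E := (toFieldOfMem τ E hE).toAlgebra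
  ∀ (σ : ℂ ≃ₐ[↥E] ℂ) (s : (FiniteAdeleRing (𝓞 ↥E) ↥E)ˣ),
    UnitaryCanonicalModel.IsArtinCorrespondent ↥E (algebraMap ↥E ℂ) s σ.toRingEquiv →
    ∀ (v₃ : Fin 3 → L) (x : Ball), IsLinePoint L τ T v₃ x →
      ∀ d : finAdelic (↥(maximalRealSubfield L)) L (IsCMField.complexConj L) 3 H,
        IsDiagTwist L H v₃ (recipFactor L (finiteIdeleRelNorm L ↥E s)) d →
        ∀ t : ↥(torusFinAdelic M),
          ((t : (FiniteAdeleRing (𝓞 M) M)ˣ) = reflexNormFiniteIdele M Φ E s) →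
          ∀ (a : finAdelic (↥(maximalRealSubfield L)) L (IsCMField.complexConj L) 3 H) (p : classGroup M L₀),
            σ • (pointsOfForm A).symm (AlgPoints.map ι (summandPointExt M Sc L₀ K p x a)) =
              (pointsOfForm A).symm (AlgPoints.map ι (summandPointExt M Sc L₀ K (classOf M L₀ t * p) x (d * a)))

/-- **`Aut(ℂ/E)`-STABILITY of the image of `ι` on complex points** (the hypothesis of [Deligne 1971] Cor. 5.7 «`Y` stable sous `Aut(ℂ/E)`»,
on points — enough for a reduced image): every `σ ∈ Aut(ℂ/E)` carries every point `ι(P)` of the image to a point `ι(Q)` of the image.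
A predicate; nothing asserted. [cite: Deligne1971TravauxShimura, Cor. 5.7 p. 156] [cite: Milne2005ShimuraVarieties, §13 p. 117] -/
def ImageStable (E : IntermediateField ℚ ℂ) (L₀ : C5.OpenCompactSubgroup ↥(torusFinAdelic M)) (Sc : ComplexRecordSystem L H τ T hT K₀)
    (K : C5.SmallLevel K₀) (A : SchemeOver ↥E) (ι : (complexSystemExt M Sc L₀).obj K ⟶ (Motives.baseChange ↥E ℂ).obj A) : Prop :=
  ∀ (σ : ℂ ≃ₐ[↥E] ℂ) (P : ComplexPoints ((complexSystemExt M Sc L₀).obj K)),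
    ∃ Q : ComplexPoints ((complexSystemExt M Sc L₀).obj K),
      σ • (pointsOfForm A).symm (AlgPoints.map ι P) = (pointsOfForm A).symm (AlgPoints.map ι Q)

/-- **THE POSITED OBJECT (interface; S1 ∧ S2 ∧ S4 at level `K`): an AMBIENT RECEPTACLE** for `Sh_{K×L₀}(G̃_M, X̃_M)_ℂ` over `E` — an `E`-scheme
`A` with a closed immersion `ι` of the complex tower at level `K` into `A ⊗_E ℂ` through which (62) holds at the diagonal special pairs.  The
intended instance is the Siegel modular variety of [Deligne 1979] Prop. 2.3.10's symplectic embedding at a neat level `K‡ ⊇ K × L₀` with its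
canonical (= moduli) structure: field `A` = S1 ([MumfordFogartyKirwan1994] Thm. 7.9; [Deligne1971TravauxShimura] Thm. 4.21), field
`isClosedImmersion` = S2 ([Deligne1971TravauxShimura] Prop. 1.15), field `reciprocity` = S4 ([Shimura1998] Thm. 18.6 at the CM points of the image).
These three fields ARE the signature of the rung-0 split of `stub_ambientReceptacle`.  PINNING AT SPLIT TIME (ref2 N2): when S1 is stated on
its own, the receptacle must be PINNED to the Siegel moduli scheme (`A := Sh_{K‡}(GSp, S^±)^{can} ⊗_ℚ E` as a named object, `ι :=` the map of
[Deligne 1971] Prop. 1.15), so that S1/S2/S4 cannot be discharged by re-proving I-1′ levelwise; unpinned, `AmbientReceptacleExists` is I-1′ at one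
level minus the tower/translation data.  EXISTENCE is NOT smuggled in: it is the separate statement `AmbientReceptacleExists` (planner rule
«interface + construction statement»); the interface is inhabited from the leaf (§4) and excludes the junk receptacles checked by ref2 (restriction
of scalars fails `reciprocity`; `Spec E` / `∅` admit no closed immersion).
[cite: Deligne1979ShimuraVarieties, Prop. 2.3.10 (PDF p. 32), Criterion 2.3.1 (PDF p. 29)] [cite: Deligne1971TravauxShimura, Prop. 1.15 p. 132, Thm. 4.21 p. 152] -/
structure AmbientReceptacle (Φ : CMType M) (E : IntermediateField ℚ ℂ) [FiniteDimensional ℚ ↥E] (hE : ∀ x : L, τ x ∈ E)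
    (L₀ : C5.OpenCompactSubgroup ↥(torusFinAdelic M)) (Sc : ComplexRecordSystem L H τ T hT K₀) (K : C5.SmallLevel K₀) where
  /-- S1: the ambient `E`-scheme (Siegel modular variety `Sh_{K‡}(GSp(W ⊕ W₀), S^±) ⊗_ℚ E`). -/
  A : SchemeOver ↥E
  /-- S2: the embedding of `Sh_{K×L₀}(G̃_M, X̃_M)_ℂ` into `A ⊗_E ℂ` … -/
  ι : (complexSystemExt M Sc L₀).obj K ⟶ (Motives.baseChange ↥E ℂ).obj A
  /-- S2: … which is a closed immersion ([Deligne 1971] Prop. 1.15, the level `K × L₀` being neat). -/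
  isClosedImmersion : IsClosedImmersion ι.left
  /-- S4: Shimura reciprocity (62) at the images of the diagonal special pairs, in `A`'s `E`-structure. -/
  reciprocity : ReciprocityThrough M Φ E hE L₀ Sc K A ι

end Receptacle

/-! ### §2. The three statements (typed over existing declarations; the binder block is that of `Aux.canonicalModel_exists_ext_printed` verbatim) -/

/-- **S1+S2+S4 (construction statement for the posited object): an ambient receptacle exists at every small level.**  Printed proof: the Siegel
modular variety of [Deligne 1979] Prop. 2.3.10's embedding `(G̃_M, X̃_M) ↪ (GSp(W ⊕ W₀), S^±)` (`W = V ⊗_{L,j} M` with `tr_{M/ℚ}(ξ·H_M)`, `W₀ = M`;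
`(g,t) ↦ (g ⊗ t, t)`, common multiplier `t·t̄`; Hodge type because `Φ` is adapted, `h_x(z)·h_Φ(z)` of type `{(-1,0),(0,-1)}`), its canonical
`ℚ`-model = Mumford's moduli scheme ([Deligne 1971] Thm. 4.21 / Exemple 5.8), the closed immersion of [Deligne 1971] Prop. 1.15 at a neat level
`K‡ ⊇ K × L₀`, and (62) at the image points = the main theorem of complex multiplication for the CM abelian varieties `A_{([x,aK],p)}` (tree:
`shimura1998_thm18_6`, `shimuraTaniyamaPair`), the reflex norm of `(T₃ × T₀(M), μ_x + μ_Φ)` being `(r_x ∘ N_{E/τL}, N_{E,Φ})`.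
WHY IT MIGHT FAIL (as typed): only through a slip in the typed reflex-norm bookkeeping of `IsCanonicalDescentAtExt` (sign of `μ_x = [τ̄] - [τ]`,
the side on which `d` and `t` multiply) — the same exposure as I-1′ itself; mathematically it is [Deligne 1979] 2.3.1's input.  SIZE: XL (needs
S1's object).  [cite: Deligne1979ShimuraVarieties, Prop. 2.3.10 (PDF p. 32)] [cite: Deligne1971TravauxShimura, Thm. 4.21 p. 152, Prop. 1.15 p. 132, Exemple 5.8 p. 157]
[cite: MumfordFogartyKirwan1994, Ch. 7 §3 Thm. 7.9] [cite: Shimura1998, §18.6 Thm. 18.6] -/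
def AmbientReceptacleExists : Prop :=
  ∀ (L : Type) [Field L] [NumberField L] [IsCMField L] (H : Matrix (Fin 3) (Fin 3) L) (τ : L →+* ℂ)
    (T : GL (Fin 3) ℂ) (hT : formCongr (starRingEnd ℂ) T (H.map τ) = BallModel.J),
    (∀ τ' : L →+* ℂ, InfinitePlace.mk τ' ≠ InfinitePlace.mk τ → (H.map τ').PosDef) →
    (∀ v : Fin 3 → L, ShimuraVarieties.hermForm (cmConjRingHom L) H v v = 0 → v = 0) →
    ∀ K₀ : C5.OpenCompactSubgroup ↥(finAdelic (↥(maximalRealSubfield L)) L (IsCMField.complexConj L) 3 H),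
      (∀ g : finAdelic (↥(maximalRealSubfield L)) L (IsCMField.complexConj L) 3 H,
        ∀ γ ∈ arithmeticLevel (↥(maximalRealSubfield L)) L (IsCMField.complexConj L) 3 H
          (K₀.1.map (MulAut.conj g).toMonoidHom), IsOfFinOrder γ → γ = 1) →
        ∀ (Sc : ComplexRecordSystem L H τ T hT K₀) (M : Type) [Field M] [NumberField M] [IsCMField M] (j : L →+* M)
          (Φ : CMType M), IsExtAdapted τ j Φ →
          ∀ (E : IntermediateField ℚ ℂ) [FiniteDimensional ℚ ↥E] (hE : ∀ x : L, τ x ∈ E), traceField Φ ≤ E →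
            ∀ (L₀ : C5.OpenCompactSubgroup ↥(torusFinAdelic M)) (K : C5.SmallLevel K₀),
              Nonempty (AmbientReceptacle M Φ E hE L₀ Sc K)

/-- **S5: closed + reciprocity at the special pairs ⟹ the image is `Aut(ℂ/E)`-stable** ([Deligne 1971] 5.2 «l'ensemble des points spéciaux … est
dense» — here the diagonal special pairs `([x, aK], p)`, `x` running over the line points `IsLinePoint L τ T v₃ x`, `a` over `G(𝔸_f)`, are
Zariski dense in every component of `Sh_{K×L₀}(G̃_M, X̃_M)_ℂ` (real approximation for `U(H)(ℚ)` acting on the ball); `σ` acts on `A(ℂ)` by a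
Zariski homeomorphism, the image of the closed immersion `ι` is closed, and by `reciprocity` `σ` maps the dense set of special image points into
the image, hence the whole image).  Inputs the prover must find or supply: an Artin correspondent `s` for every `σ` (tree:
`UnitaryAuxiliaryReflexArtinSurjective`), a diagonal twist `d` for every `(v₃, r)`, `N_{E,Φ}(s) ∈ T₀(M)(𝔸_f)`.  WHY IT MIGHT FAIL: if one of
those three existence lemmas failed the reciprocity hypothesis would be vacuous and S5 false for a non-stable `ι` — check them FIRST (cheapest
falsifier).  SIZE: M. [cite: Deligne1971TravauxShimura, 5.2 p. 155, Cor. 5.7 p. 156] [cite: Milne2005ShimuraVarieties, Lemma 13.5 p. 118 and §13 p. 117] -/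
def ImageStableOfReciprocity : Prop :=
  ∀ (L : Type) [Field L] [NumberField L] [IsCMField L] (H : Matrix (Fin 3) (Fin 3) L) (τ : L →+* ℂ)
    (T : GL (Fin 3) ℂ) (hT : formCongr (starRingEnd ℂ) T (H.map τ) = BallModel.J),
    (∀ τ' : L →+* ℂ, InfinitePlace.mk τ' ≠ InfinitePlace.mk τ → (H.map τ').PosDef) →
    (∀ v : Fin 3 → L, ShimuraVarieties.hermForm (cmConjRingHom L) H v v = 0 → v = 0) →
    ∀ K₀ : C5.OpenCompactSubgroup ↥(finAdelic (↥(maximalRealSubfield L)) L (IsCMField.complexConj L) 3 H),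
      (∀ g : finAdelic (↥(maximalRealSubfield L)) L (IsCMField.complexConj L) 3 H,
        ∀ γ ∈ arithmeticLevel (↥(maximalRealSubfield L)) L (IsCMField.complexConj L) 3 H
          (K₀.1.map (MulAut.conj g).toMonoidHom), IsOfFinOrder γ → γ = 1) →
        ∀ (Sc : ComplexRecordSystem L H τ T hT K₀) (M : Type) [Field M] [NumberField M] [IsCMField M] (j : L →+* M)
          (Φ : CMType M), IsExtAdapted τ j Φ →
          ∀ (E : IntermediateField ℚ ℂ) [FiniteDimensional ℚ ↥E] (hE : ∀ x : L, τ x ∈ E), traceField Φ ≤ E →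
            ∀ (L₀ : C5.OpenCompactSubgroup ↥(torusFinAdelic M)) (K : C5.SmallLevel K₀)
              (R : AmbientReceptacle M Φ E hE L₀ Sc K), ImageStable M E L₀ Sc K R.A R.ι

/-- **S3: CLOSURE DESCENT ([Deligne 1971] Cor. 5.7 at finite level, with the functoriality bookkeeping of 5.9).**  If at every small level `K` the
complex tower `Sh_{K×L₀}(G̃_M, X̃_M)_ℂ` sits, by a closed immersion through which (62) holds at the diagonal special pairs, `Aut(ℂ/E)`-stably
inside an `E`-scheme, then the tower has an `E`-form `N` with the class-group translations descended and (62) at the diagonal special pairs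
(the MATRIX of `Aux.canonicalModel_exists_ext_printed`, verbatim).  Printed proof: (a) Galois descent of the stable closed (reduced) subscheme
along `ℂ/E` gives `N_K ⊂ A_K` over `E` with `N_K ⊗_E ℂ ≅` the image `≅ Sh_{K×L₀}(G̃_M, X̃_M)_ℂ` (Cor. 5.7; `ℂ^{Aut(ℂ/E)} = E`); (b) the transition
maps and the translations `translMorExt K c` descend because they commute with `Aut(ℂ/E)` on the Zariski-dense special points — reciprocity is
natural in `K`, and `σ·(c·p) = c·(N_{E,Φ}(s)·p)` as the class group is abelian — and two morphisms of reduced varieties agreeing on a dense set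
agree; a morphism of `E`-varieties commuting with `Aut(ℂ/E)` on `ℂ`-points is defined over `E`; (c) (62) for `N` = (62) for `A` pulled back along
the closed immersion (injective on points).  Build (a)–(c) ON the I-6 crew's Galois-descent files (`GaloisDescentTwist.exists_datum` /
`exists_descended_form_tw`, `ComplexRecordSystem.IsTwist`, `isCanonicalDescentOver_of_gal_twist`), not separately (B1-F1-DAG v1.3).
WHY IT MIGHT FAIL: descent along the infinite extension `ℂ/E` needs the subscheme to be of finite type and the stabiliser argument to pass through
a finitely generated field — routine for quasi-projective varieties but not yet in the tree (the I-6 files descend FORMS given a finite Galois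
datum, [Deligne 1971] Lemme 5.10.1 shape); effective descent along `ℂ/E` of finite-type closed subschemes AND of morphisms (J. S. Milne, *Algebraic Geometry*
notes, Ch. 16 «Descent theory» shape; ref2 N3) is the honest extra input.  SIZE: M–L.
[cite: Deligne1971TravauxShimura, Cor. 5.7 p. 156, Variante 5.9 p. 157, 5.2 p. 155] [cite: Milne2005ShimuraVarieties, §13 p. 117, Lemma 13.5 p. 118; §14 pp. 126–127] -/
def ClosureDescent : Prop :=
  ∀ (L : Type) [Field L] [NumberField L] [IsCMField L] (H : Matrix (Fin 3) (Fin 3) L) (τ : L →+* ℂ)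
    (T : GL (Fin 3) ℂ) (hT : formCongr (starRingEnd ℂ) T (H.map τ) = BallModel.J),
    (∀ τ' : L →+* ℂ, InfinitePlace.mk τ' ≠ InfinitePlace.mk τ → (H.map τ').PosDef) →
    (∀ v : Fin 3 → L, ShimuraVarieties.hermForm (cmConjRingHom L) H v v = 0 → v = 0) →
    ∀ K₀ : C5.OpenCompactSubgroup ↥(finAdelic (↥(maximalRealSubfield L)) L (IsCMField.complexConj L) 3 H),
      (∀ g : finAdelic (↥(maximalRealSubfield L)) L (IsCMField.complexConj L) 3 H,
        ∀ γ ∈ arithmeticLevel (↥(maximalRealSubfield L)) L (IsCMField.complexConj L) 3 H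
          (K₀.1.map (MulAut.conj g).toMonoidHom), IsOfFinOrder γ → γ = 1) →
        ∀ (Sc : ComplexRecordSystem L H τ T hT K₀) (M : Type) [Field M] [NumberField M] [IsCMField M] (j : L →+* M)
          (Φ : CMType M), IsExtAdapted τ j Φ →
          ∀ (E : IntermediateField ℚ ℂ) [FiniteDimensional ℚ ↥E] (hE : ∀ x : L, τ x ∈ E), traceField Φ ≤ E →
            ∀ L₀ : C5.OpenCompactSubgroup ↥(torusFinAdelic M),
              (∀ K : C5.SmallLevel K₀, ∃ R : AmbientReceptacle M Φ E hE L₀ Sc K, ImageStable M E L₀ Sc K R.A R.ι) →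
              ∃ (N : C5.SmallLevel K₀ ⥤ SchemeOver ↥E)
                (ρ : ∀ K : C5.SmallLevel K₀, classGroup M L₀ →* Aut (N.obj K))
                (e : (N ⋙ Motives.baseChange ↥E ℂ) ≅ complexSystemExt M Sc L₀),
                (∀ (K K' : C5.SmallLevel K₀) (f : K ⟶ K') (c : classGroup M L₀),
                    (ρ K c).hom ≫ N.map f = N.map f ≫ (ρ K' c).hom) ∧
                (∀ (K : C5.SmallLevel K₀) (c : classGroup M L₀),
                    (Motives.baseChange ↥E ℂ).map (ρ K c).hom ≫ e.hom.app K = e.hom.app K ≫ translMorExt M Sc L₀ K c) ∧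
                IsCanonicalDescentAtExt M Φ E hE L₀ Sc N e

end Summit.HodgeConjecture.CorCM.HypDel.ExtReceptacle
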